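import Summits.ABC.StewartYu.ArchG3LineEnd
import Summits.ABC.StewartYu.ArchG3LinesV
import Summits.ABC.StewartYu.ArchG3StartRec
import Summits.ABC.StewartYu.ArchG3VirtualBox
import HarnessLib

/-!
# Cell abc-stewartyu, WP-L.A (crux r2 `ArchCoreRat`, stmt-ABC-20502), line `arch-g3-frame` v4: the SUPPLIES of the one-stage frame
# and their composition into `FrameArchW` (plan RULINGS R42/R43: six stubs, single owners; registrar p4 g10)

`Summits/ABC/StewartYu/ArchG3LineSupply.lean` — cell `abc-stewartyu` (HOME `run/shared/lean/pub/abc-stewartyu/`), route `YuMatveevShapeRat`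
(rung A1.L).  Plain `Prop`-valued definitions (the texts of the OPEN stubs of the r2 line, so that every owner's helper file proves a NAMED
tree predicate) and the composition theorem; no named fact, no numerics.

The v4 data flow for ONE reduced pivot-weighted datum `(a, b, A, B, k₀)` under the negated bound and in the regime, at a constant `c`:

* **`StartSupply c`** (stub `stub_satStartArch`, p1 with lp-1's kit): a saturated frame `S(θ) := setupOf n θ _ b̃ j̃₀ _` with its
  saturation datum `F : S.SatData` over the ORIGINAL `(a, b)` (`F.αo = a`, `F.bo = b`), the record `P : ArchG3Rec n` ON THE DATUM'S LETTERS
  (`P.A = A`, `P.N = F.N = |det F.C|`, `P.W = log(eB)`), the independence of the square classes of `θ`, the smallness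
  `|Λ̃/b̃_{j̃₀}| ≤ exp(−cⁿ·Ω·W)` (the negated bound: `Λ̃ = Λ`), and — for EVERY level-`0` direction `(cl, el)` with `cl 0 ≠ 0`,
  `el 0 j̃₀ = 0` — the Siegel family `𝔏`, coefficients `pv`, the degree/count bounds of `unkA P.L₀ 𝔏` and the level-`(0,0)` state
  `ArchLevelStateQ (VBoxQ ν (LνR P)) P.H P.Ŝ (sθR F P) (unkA P.L₀ 𝔏) pv ⌈#unkA·AmaxR F P (cl 0) (el 0)⌉ P.wl P.γb cl el 0 (Nf 0 0) (Tf 0 0)`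
  (= lp-1's `archLevelStateQ_zero_closed`, verbatim conclusion);
* **`LinesSupply c`** (stub `stub_recLinesArch`, p5): for such START outputs, a direction schedule `(cl, el)` (`cl 0 ≠ 0`, `el 0 j̃₀ = 0`) such
  that for every admissible `𝔏` the per-level letter lines `ArchLinesHoldV F P.H P.Ŝ (sθR F P) (unkA P.L₀ 𝔏) ⌈#unkA·AmaxR…⌉ δ₀ P.wl P.γb cl el
  (LνR P) P.Nf P.Tf P.Nh` hold with `δ₀ := exp(−cⁿ·P.Ω·P.W)`;
* the packs `ArchPacksHoldV` from the lines — ✓ `archPacksHoldV_of_linesHoldV` (p5; stub `stub_packsArch` discharged);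
* **`RecordSupply`** (stub `stub_recordArch`, p4): `∀ n ≥ 2, ∃ Y, ∀ c ≥ 2^100, ∀ P, RecordArchW (c^·) Y n P.A P.D₀ P.S₀ P.X_fin P.D`;
* **`EndLetters`** (stub `stub_endLettersArch`, p4): the END letters of the record — last-level virtual box inside the END degrees
  `LνR P Ŝ j ≤ D j`, `L₀ ≤ D₀`, `(n+1)X_fin ≤ Nf Ŝ n`, `(n+1)S₀ < Tf Ŝ n`;

and `frameArchW_of_supplies`: START → LINES → packs → `lastLevelStateQ_of_packsV` (lp-1's D-generic schedule with `Q := VBoxQ`) →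
`lastLevelInv_feldR` → `ArchG3Line.EndAt` (box enlarged to `D`, record clauses at `P.A = A`) → ✓ `ArchG3Line.frameArchW_of_endAt` ⇒
`FrameArchW (c^·) Y n` for every `n ≥ 2` — so that the r2 skeleton's `ArchCoreRat_of` is `archCoreRat_of_frameW_two_le_pow` on this theorem.

WHAT THIS IS NOT: no START, no lines, no record (those are the stubs); no crux moves by itself.

References: Yu. V. Nesterenko, LNM 1819 (2003), §3.5, §4 Prop. 4.1, §5.1–5.2 (pp. 71–106); E. M. Matveev, Izv. Math. 64 (2000), (1.3).
-/

noncomputable section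

open Finset
open scoped Matrix
open Summit.ABC.StewartYu.GenThreeFrameSpecArchW (RecordArchW FrameArchW)
open Summit.ABC.StewartYu.FeldmanBasis (feldR)
open Summit.ABC.StewartYu.ArchG3FrameGlue (setupOf)

namespace Summit.ABC.StewartYu.ArchG3Line

/-! ### The supplies (texts of the open stubs) -/

/-- **What the START owes for one datum at the constant `c`** (see the module docstring). [cite: Nesterenko2003, §3.5 (3.22)–(3.30),
Prop. 3.9, §4 (4.6); shape only] -/
def StartData (c : ℝ) (n : ℕ) (a : Fin n → ℚ) (b : Fin n → ℤ) (A : Fin n → ℝ) (B : ℝ) : Prop :=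
  ∃ (θ : Fin n → ℚ) (hθ : ∀ i, 0 < θ i) (bt : Fin n → ℤ) (jt : Fin n) (hjt : bt jt ≠ 0)
    (F : (setupOf n θ hθ bt jt hjt).SatData) (P : ArchG3Rec n),
    F.αo = a ∧ F.bo = b ∧ P.A = A ∧ P.N = F.N ∧ F.C.det.natAbs = F.N ∧ P.W = Real.log (Real.exp 1 * B) ∧
    (∀ T₁ : Finset (Fin n), T₁.Nonempty → ¬ IsSquare (∏ j ∈ T₁, θ j)) ∧
    |(setupOf n θ hθ bt jt hjt).Λ / (bt jt : ℝ)| ≤ Real.exp (-(c ^ n * P.Ω * P.W)) ∧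
    ∀ (cl : ℕ → ℤ) (el : ℕ → Fin n → ℤ), cl 0 ≠ 0 → el 0 jt = 0 →
      ∃ (𝔏 : Finset (Fin n → ℤ)) (pv : ℕ × (Fin n → ℤ) → ℤ),
        (∀ i ∈ (setupOf n θ hθ bt jt hjt).unkA P.L₀ 𝔏, i.1 ≤ P.L₀) ∧
        ((setupOf n θ hθ bt jt hjt).unkA P.L₀ 𝔏).card ≤ (P.L₀ + 1) * ∏ j, ((setupOf n θ hθ bt jt hjt).LνR P 0 j + 1) ∧
        (setupOf n θ hθ bt jt hjt).ArchLevelStateQ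
          ((setupOf n θ hθ bt jt hjt).VBoxQ (Matrix.vecMulLinear F.U).toAddMonoidHom ((setupOf n θ hθ bt jt hjt).LνR P))
          P.H P.Sd ((setupOf n θ hθ bt jt hjt).sθR F P) ((setupOf n θ hθ bt jt hjt).unkA P.L₀ 𝔏) pv
          ⌈((((setupOf n θ hθ bt jt hjt).unkA P.L₀ 𝔏).card : ℕ) : ℝ) * (setupOf n θ hθ bt jt hjt).AmaxR F P (cl 0) (el 0)⌉
          P.wl P.γb cl el 0 (P.Nf 0 0) (P.Tf 0 0)

/-- **THE START SUPPLY at the constant `c`** (text of `stub_satStartArch`): every REDUCED pivot-weighted rank-`n` datum (`n ≥ 2`) under the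
negated bound `log|Λ| < −cⁿ·Ω·log(eB)` and in the regime `cⁿ·Ω·log(eB) < Σ Aⱼ|bⱼ| + log 2` receives `StartData c n a b A B`.
[cite: Nesterenko2003, §3.5, §4 (4.6); shape only] -/
def StartSupply (c : ℝ) : Prop :=
  ∀ n, 2 ≤ n → ∀ (a : Fin n → ℚ) (b : Fin n → ℤ) (A : Fin n → ℝ) (B : ℝ) (k₀ : Fin n),
    (∀ j, 0 < a j) →
    (∀ μ : Fin n → ℤ, ∏ j, a j ^ μ j = 1 → μ = 0) →
    (∀ j, Height.logHeight₁ (a j) ≤ A j) → (∀ j, 1 ≤ A j) →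
    (∀ j, b j ≠ 0) → Finset.univ.gcd b = 1 → Monotone A → (∀ j, A j ≤ A k₀) →
    (∀ j, (|b j| : ℝ) * A j ≤ B * A k₀) →
    ¬ -(c ^ n * (∏ j, A j) * Real.log (Real.exp 1 * B)) ≤ Real.log |∑ j, (b j : ℝ) * Real.log (a j : ℝ)| →
    c ^ n * (∏ j, A j) * Real.log (Real.exp 1 * B) < ∑ j, A j * |(b j : ℝ)| + Real.log 2 →
    StartData c n a b A B

/-- **THE LETTER-LINES SUPPLY at the constant `c`** (text of `stub_recLinesArch`): for every datum as in `StartSupply` and every START output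
`(θ, b̃, j̃₀, F, P)` on the datum's letters, a direction schedule `(cl, el)` with `cl 0 ≠ 0`, `el 0 j̃₀ = 0` such that for every Siegel family
`𝔏` within the START's degree/count bounds (and non-empty) the per-level letter lines `ArchLinesHoldV` hold at the record's schedules with
`δ₀ := exp(−cⁿ·P.Ω·P.W)`. [cite: Nesterenko2003, §4.2 (4.20)–(4.35), §4.3 (4.36)–(4.51); shape only] -/
def LinesSupply (c : ℝ) : Prop :=
  ∀ n, 2 ≤ n → ∀ (a : Fin n → ℚ) (b : Fin n → ℤ) (A : Fin n → ℝ) (B : ℝ) (k₀ : Fin n),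
    (∀ j, 0 < a j) →
    (∀ μ : Fin n → ℤ, ∏ j, a j ^ μ j = 1 → μ = 0) →
    (∀ j, Height.logHeight₁ (a j) ≤ A j) → (∀ j, 1 ≤ A j) →
    (∀ j, b j ≠ 0) → Finset.univ.gcd b = 1 → Monotone A → (∀ j, A j ≤ A k₀) →
    (∀ j, (|b j| : ℝ) * A j ≤ B * A k₀) →
    ¬ -(c ^ n * (∏ j, A j) * Real.log (Real.exp 1 * B)) ≤ Real.log |∑ j, (b j : ℝ) * Real.log (a j : ℝ)| →
    c ^ n * (∏ j, A j) * Real.log (Real.exp 1 * B) < ∑ j, A j * |(b j : ℝ)| + Real.log 2 →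
    ∀ (θ : Fin n → ℚ) (hθ : ∀ i, 0 < θ i) (bt : Fin n → ℤ) (jt : Fin n) (hjt : bt jt ≠ 0)
      (F : (setupOf n θ hθ bt jt hjt).SatData) (P : ArchG3Rec n),
      F.αo = a → F.bo = b → P.A = A → P.N = F.N → F.C.det.natAbs = F.N → P.W = Real.log (Real.exp 1 * B) →
      (∀ T₁ : Finset (Fin n), T₁.Nonempty → ¬ IsSquare (∏ j ∈ T₁, θ j)) →
      ∃ (cl : ℕ → ℤ) (el : ℕ → Fin n → ℤ), cl 0 ≠ 0 ∧ el 0 jt = 0 ∧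
        ∀ (𝔏 : Finset (Fin n → ℤ)),
          (∀ i ∈ (setupOf n θ hθ bt jt hjt).unkA P.L₀ 𝔏, i.1 ≤ P.L₀) →
          ((setupOf n θ hθ bt jt hjt).unkA P.L₀ 𝔏).card ≤ (P.L₀ + 1) * ∏ j, ((setupOf n θ hθ bt jt hjt).LνR P 0 j + 1) →
          1 ≤ ((setupOf n θ hθ bt jt hjt).unkA P.L₀ 𝔏).card →
          (setupOf n θ hθ bt jt hjt).ArchLinesHoldV F P.H P.Sd ((setupOf n θ hθ bt jt hjt).sθR F P)
            ((setupOf n θ hθ bt jt hjt).unkA P.L₀ 𝔏)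
            ⌈((((setupOf n θ hθ bt jt hjt).unkA P.L₀ 𝔏).card : ℕ) : ℝ) * (setupOf n θ hθ bt jt hjt).AmaxR F P (cl 0) (el 0)⌉
            (Real.exp (-(c ^ n * P.Ω * P.W))) P.wl P.γb cl el ((setupOf n θ hθ bt jt hjt).LνR P) P.Nf P.Tf P.Nh

/-- **THE RECORD SUPPLY** (text of `stub_recordArch`; PROVED: `ArchG3Rec.recordSupplyArch`, p4): for every rank `n ≥ 2` a slack function
`Y` (depending on `n` only) such that for every `c ≥ 2^100` and every `P : ArchG3Rec n` the record obligations hold at `P`'s letters.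
[cite: Nesterenko2003, §5.2; shape only] -/
def RecordSupply : Prop :=
  ∀ n : ℕ, 2 ≤ n → ∃ Y : ℕ → ℝ, ∀ c : ℝ, (2 : ℝ) ^ 100 ≤ c → ∀ P : ArchG3Rec n,
    RecordArchW (fun r => c ^ r) Y n P.A P.D₀ P.S₀ P.Xfin P.D

/-- **THE END LETTERS of the record** (text of `stub_endLettersArch`, p4): the last-level virtual box lies inside the END degrees, `L₀ ≤ D₀`, the END
range and order. [cite: Nesterenko2003, §5.2 (5.5)–(5.8), (5.12); shape only] -/
def EndLetters : Prop :=
  ∀ (S : ArchG3Setup) (P : ArchG3Rec S.n), (∀ j, S.LνR P P.Sd j ≤ P.D j) ∧ P.L₀ ≤ P.D₀ ∧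
    (S.n + 1) * P.Xfin ≤ P.Nf P.Sd S.n ∧ (S.n + 1) * P.S₀ < P.Tf P.Sd S.n

/-! ### Composition -/

/-- `ν = (· ᵥ* U)` is injective (`U·C = N·1`, `N ≠ 0`). [folklore] -/
theorem vecMul_U_injective {S : ArchG3Setup} (F : S.SatData) :
    ∀ w₁ w₂ : Fin S.n → ℤ, w₁ ᵥ* F.U = w₂ ᵥ* F.U → w₁ = w₂ := by
  intro w₁ w₂ h
  have h1 := F.N_smul_eq_vecMul_vecMul w₁
  have h2 := F.N_smul_eq_vecMul_vecMul w₂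
  rw [h] at h1
  have h3 : (F.N : ℤ) • w₁ = (F.N : ℤ) • w₂ := by rw [h1, h2]
  have hN : (F.N : ℤ) ≠ 0 := by exact_mod_cast F.hN.ne'
  funext k
  have := congrFun h3 k
  simp only [Pi.smul_apply, smul_eq_mul] at this
  exact mul_left_cancel₀ hN this

/-- **THE COMPOSITION**: at a constant `c`, the START supply, the letter-lines supply, a record supply at this `c` and the END letters give the
archimedean frame `FrameArchW (c^·) Y n` at every rank `n ≥ 2` — lines ⇒ packs (✓ `archPacksHoldV_of_linesHoldV`), packs ⇒ last level
(✓ `lastLevelStateQ_of_packsV` with `Q := VBoxQ`, hooks ✓ `vboxQ_halfStep`/`vboxV_of_vboxQ`), last level ⇒ `EndAt` (✓ `lastLevelInv_feldR`,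
box enlarged to the END degrees), `EndAt` ⇒ frame (✓ `frameArchW_of_endAt`). [cite: Nesterenko2003, §4 Prop. 4.1, §5.1–5.2] -/
theorem frameArchW_of_supplies {c : ℝ} (hS : StartSupply c) (hL : LinesSupply c)
    (hR : ∀ n : ℕ, 2 ≤ n → ∃ Y : ℕ → ℝ, ∀ P : ArchG3Rec n, RecordArchW (fun r => c ^ r) Y n P.A P.D₀ P.S₀ P.Xfin P.D)
    (hE : EndLetters) : ∀ n, 2 ≤ n → ∃ Y : ℕ → ℝ, FrameArchW (fun r => c ^ r) Y n := by
  classical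
  intro n hn
  obtain ⟨Y, hY⟩ := hR n hn
  refine ⟨Y, ?_⟩
  intro a b A B k₀ ha hind hA hA1 hbz hgcd hmono hmax hBw hneg hreg
  obtain ⟨θ, hθ, bt, jt, hjt, F, P, hαo, hbo, hPA, hPN, hdet, hPW, hindθ, hΛ, hstart⟩ :=
    hS n hn a b A B k₀ ha hind hA hA1 hbz hgcd hmono hmax hBw hneg hreg
  obtain ⟨cl, el, hc0, he0, hlines⟩ :=
    hL n hn a b A B k₀ ha hind hA hA1 hbz hgcd hmono hmax hBw hneg hreg θ hθ bt jt hjt F P hαo hbo hPA hPN hdet hPW hindθ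
  obtain ⟨𝔏, pv, hdeg, hcount, h00⟩ := hstart cl el hc0 he0
  -- the unknown set is non-empty (the level-`0` function is non-zero)
  have hU1 : 1 ≤ ((setupOf n θ hθ bt jt hjt).unkA P.L₀ 𝔏).card := by
    obtain ⟨B₀, v₀, lo₀, γ₀, hBU₀, -, -, hinv₀, -⟩ := h00
    obtain ⟨i, hi, -⟩ := hinv₀.nonzero
    exact Finset.card_pos.mpr ⟨i, hBU₀ hi⟩
  have hlin := hlines 𝔏 hdeg hcount hU1
  have hpacks := (setupOf n θ hθ bt jt hjt).archPacksHoldV_of_linesHoldV F hlin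
  -- the schedule hooks
  have hn1 : 1 ≤ (setupOf n θ hθ bt jt hjt).n := by show 1 ≤ n; omega
  have hΛ' : |(setupOf n θ hθ bt jt hjt).Λ / ((setupOf n θ hθ bt jt hjt).b (setupOf n θ hθ bt jt hjt).j₀ : ℝ)| ≤ Real.exp (-(c ^ n * P.Ω * P.W)) := hΛ
  have hQhalf : ∀ (lev : ℕ) (B₁ : Finset (ℕ × (Fin n → ℤ))) (v : ℕ × (Fin n → ℤ) → Fin n → ℤ) (i₀ : ℕ × (Fin n → ℤ)),
      i₀ ∈ B₁ → (setupOf n θ hθ bt jt hjt).VBoxQ (Matrix.vecMulLinear F.U).toAddMonoidHom ((setupOf n θ hθ bt jt hjt).LνR P) B₁ v lev →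
      (setupOf n θ hθ bt jt hjt).VBoxQ (Matrix.vecMulLinear F.U).toAddMonoidHom ((setupOf n θ hθ bt jt hjt).LνR P) ((setupOf n θ hθ bt jt hjt).parityClass v B₁ i₀) ((setupOf n θ hθ bt jt hjt).halfDiff v i₀) (lev + 1) :=
    fun lev B₁ v i₀ hi₀ hQ => ArchG3Setup.vboxQ_halfStep (fun j => (setupOf n θ hθ bt jt hjt).LνR_succ P lev j) hi₀ hQ
  have hQV : ∀ (lev : ℕ) (B₁ : Finset (ℕ × (Fin n → ℤ))) (v : ℕ × (Fin n → ℤ) → Fin n → ℤ),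
      (setupOf n θ hθ bt jt hjt).VBoxQ (Matrix.vecMulLinear F.U).toAddMonoidHom ((setupOf n θ hθ bt jt hjt).LνR P) B₁ v lev → ∀ i ∈ B₁, ∀ j, |(v i ᵥ* F.U) j| ≤ ((setupOf n θ hθ bt jt hjt).LνR P lev j : ℤ) :=
    fun lev B₁ v hQ i hi j => ArchG3Setup.vboxV_of_vboxQ lev B₁ v hQ i hi j
  have hwl : ∀ lev, P.wl (lev + 1) = P.wl lev / 2 := fun lev => (P.wl_facts lev).1
  have hγb : ∀ lev, P.wl lev / 2 ≤ P.γb (lev + 1) := fun lev => (P.γb_facts lev).2.2.1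
  have hlast := (setupOf n θ hθ bt jt hjt).lastLevelStateQ_of_packsV F hn1 hindθ hΛ' hQhalf hQV hwl hγb hpacks h00
  obtain ⟨Bf, v, lo, γ, hBU, hinj, hinv, hQ⟩ := ArchG3Setup.lastLevelInv_feldR hlast
  -- the END letters and the record
  obtain ⟨hLD, hL0D0, hX, hSlt⟩ := hE (setupOf n θ hθ bt jt hjt) P
  have hrec : RecordArchW (fun r => c ^ r) Y n A P.D₀ P.S₀ P.Xfin P.D := by rw [← hPA]; exact hY P
  -- the saturation relations over the original datum
  have hN1 : 1 ≤ F.N := F.hN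
  have hUrel : ∀ i, θ i ^ F.N = ∏ j, a j ^ F.U i j := by
    intro i; rw [← hαo]; exact F.hU i
  have hbU : bt ᵥ* F.U = (F.N : ℤ) • b := by
    rw [← hbo]; exact F.N_smul_bo_eq.symm
  have hνinj := vecMul_U_injective F
  have hdegD : ∀ i ∈ Bf, i.1 ≤ P.D₀ := fun i hi => (hdeg i (hBU hi)).trans hL0D0
  have hbox : ∀ i ∈ Bf, ∀ j, |(v i ᵥ* F.U) j| ≤ (P.D j : ℤ) := by
    intro i hi j
    have h1 := hQV P.Sd Bf v hQ i hi j
    have h2 : ((setupOf n θ hθ bt jt hjt).LνR P P.Sd j : ℤ) ≤ (P.D j : ℤ) := by exact_mod_cast hLD j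
    exact h1.trans h2
  have hEnd : EndAt c Y n a b A :=
    ⟨θ, hθ, bt, jt, hjt, F.U, F.N, P.H, Bf, v, pv, lo, (setupOf n θ hθ bt jt hjt).Lb ((setupOf n θ hθ bt jt hjt).sθR F P) P.Sd,
      ⌈((((setupOf n θ hθ bt jt hjt).unkA P.L₀ 𝔏).card : ℕ) : ℝ) * (setupOf n θ hθ bt jt hjt).AmaxR F P (cl 0) (el 0)⌉, P.wl P.Sd, γ, cl P.Sd, el P.Sd,
      P.Nf P.Sd n, P.Tf P.Sd n, P.D₀, P.S₀, P.Xfin, P.D, hN1, hUrel, hbU, hνinj, hinv, hdegD, hinj, hbox, hX, hSlt, hrec⟩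
  exact frameArchW_of_endAt c Y n a b A k₀ ha hind (hbz k₀) hEnd


/-! ### The END letters hold -/

/-- `LνR P s j = (2·Bv j + 1)/2^s` (iterated halving). [folklore] -/
theorem LνR_eq_div {S : ArchG3Setup} (P : ArchG3Rec S.n) (s : ℕ) (j : Fin S.n) :
    S.LνR P s j = (2 * P.Bv j + 1) / 2 ^ s := by
  induction s with
  | zero => rw [S.LνR_zero]; simp
  | succ s ih => rw [S.LνR_succ, ih, Nat.div_div_eq_div_mul, pow_succ]

/-- **The END letters hold for every record** (the content of `stub_endLettersArch`): `LνR P Ŝ j ≤ D j`, `L₀ ≤ D₀`, `(n+1)X_fin ≤ Nf Ŝ n`,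
`(n+1)S₀ < Tf Ŝ n`. [cite: Nesterenko2003, §5.2 (5.5)–(5.8), (5.12); shape only] -/
theorem endLetters_holds : EndLetters := by
  intro S P
  refine ⟨fun j => ?_, by unfold ArchG3Rec.D₀; omega, ?_, ?_⟩
  · -- the last-level virtual box inside the END degrees
    rw [LνR_eq_div]
    obtain ⟨hσ0, -, -, hBv⟩ := P.box_facts j
    obtain ⟨hA0, hA1, -⟩ := P.A_facts j
    obtain ⟨hN0, hN1, -⟩ := P.N_facts
    have hK1 : (1 : ℝ) ≤ ArchG3Par.K S.n := by exact_mod_cast ArchG3Par.one_le_K S.n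
    have hL0 : (0 : ℝ) ≤ P.L := Nat.cast_nonneg _
    have h2S : (1 : ℝ) ≤ 2 ^ P.Sd := one_le_pow₀ (by norm_num)
    set y : ℝ := (ArchG3Par.K S.n : ℝ) * P.N * P.L / (2 ^ P.Sd * P.A j) with hy
    have hy0 : 0 ≤ y := by rw [hy]; have := ArchG3Par.K_pos S.n; positivity
    -- real bound: `(2Bv+1)/2^Ŝ ≤ (N L/A + 1)/2^Ŝ ≤ y + 1`
    have h1 : (((2 * P.Bv j + 1) / 2 ^ P.Sd : ℕ) : ℝ) ≤ ((2 * P.Bv j + 1 : ℕ) : ℝ) / 2 ^ P.Sd := by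
      have := Nat.cast_div_le (α := ℝ) (m := 2 * P.Bv j + 1) (n := 2 ^ P.Sd)
      push_cast at this ⊢; exact this
    have h2 : ((2 * P.Bv j + 1 : ℕ) : ℝ) ≤ (P.N : ℝ) * P.L / P.A j + 1 := by
      push_cast
      have e : (P.N : ℝ) * P.L / P.A j = 2 * ((P.N : ℝ) * P.σ j) := by unfold ArchG3Rec.σ; field_simp
      rw [e]; linarith
    have h3 : (P.N : ℝ) * P.L / P.A j ≤ y * 2 ^ P.Sd := by
      rw [hy, div_mul_eq_mul_div, le_div_iff₀ (by positivity)]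
      have : (P.N : ℝ) * P.L * (2 ^ P.Sd * P.A j) = ((P.N : ℝ) * P.L * 2 ^ P.Sd) * P.A j := by ring
      rw [div_mul_eq_mul_div, this, mul_div_assoc, div_self hA0.ne', mul_one]
      have h0 : 0 ≤ (P.N : ℝ) * P.L * 2 ^ P.Sd := by positivity
      nlinarith
    have h4 : (((2 * P.Bv j + 1) / 2 ^ P.Sd : ℕ) : ℝ) ≤ y + 1 := by
      have h5 : ((2 * P.Bv j + 1 : ℕ) : ℝ) / 2 ^ P.Sd ≤ (y * 2 ^ P.Sd + 1) / 2 ^ P.Sd :=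
        div_le_div_of_nonneg_right (h2.trans (by linarith)) (by positivity)
      have h6 : (y * 2 ^ P.Sd + 1) / 2 ^ P.Sd ≤ y + 1 := by
        rw [div_le_iff₀ (by positivity)]; nlinarith
      linarith
    have h7 : (((2 * P.Bv j + 1) / 2 ^ P.Sd : ℕ) : ℝ) < (⌊y⌋₊ : ℝ) + 2 := by linarith [Nat.lt_floor_add_one y]
    have h8 : (2 * P.Bv j + 1) / 2 ^ P.Sd < ⌊y⌋₊ + 2 := by exact_mod_cast h7
    unfold ArchG3Rec.D
    rw [← hy]
    omega
  · -- the END range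
    unfold ArchG3Rec.Xfin ArchG3Rec.Nf
    exact Nat.mul_div_le _ _
  · -- the END order
    show (S.n + 1) * P.S₀ < P.Mord P.Sd S.n
    unfold ArchG3Rec.S₀ ArchG3Rec.Mord
    have hT : 1 ≤ P.T P.Sd := le_max_left _ _
    have h1 : P.M / (S.n + 2) ^ 4 = P.M / (S.n + 2) ^ 3 / (S.n + 2) := by
      rw [Nat.div_div_eq_div_mul, ← pow_succ]
    have key : (S.n + 1) * (P.M / (S.n + 2) ^ 4) ≤ P.M / (S.n + 2) ^ 3 :=
      calc (S.n + 1) * (P.M / (S.n + 2) ^ 4) ≤ (S.n + 2) * (P.M / (S.n + 2) ^ 4) := Nat.mul_le_mul_right _ (by omega)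
        _ = (S.n + 2) * (P.M / (S.n + 2) ^ 3 / (S.n + 2)) := by rw [h1]
        _ ≤ P.M / (S.n + 2) ^ 3 := Nat.mul_div_le _ _
    have hT1 : 1 ≤ (S.n + 1 - S.n) * P.T P.Sd := by rw [Nat.add_sub_cancel_left, one_mul]; exact hT
    omega

end Summit.ABC.StewartYu.ArchG3Line

end
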